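import Literature.Analysis.UnboundedOperators.LinearMildUniqueness
import Literature.Analysis.UnboundedOperators.SemilinearMildTubeShift
import Mathlib.Analysis.Normed.Operator.Compact.Basic
import HarnessLib

/-!
# The linear mild equation `w(t) = T(t) h − ∫₀ᵗ K(t − s) G(s) ds`: stability uniformly in the horizon,
# identification of solutions built from positive times, compactness of the solution operators

Analysis/UnboundedOperators support file (everything proved; no definitions, no named facts), continuing
`LinearMildUniqueness.lean` (horizon-uniform Lipschitz stability `exists_forall_norm_sub_le_of_linearMild`,
`linearMild_unique`) — the LINEAR companion of `SemilinearMildTubeLipschitz.lean` / `SemilinearMildTubeShift.lean`.  Let `E` be a real Banach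
space, `T(t)` (`t ≥ 0`) contractions, `K(t)` (`t > 0`) bounded operators, strongly continuous on `(0, ∞)`
with the weakly singular bound `‖K(t)‖ ≤ C t^{−α}` (`C ≥ 0`, `α < 1`) — the abstract `e^{-tA}`, `A^α e^{-tA}` of
D. Henry, *Geometric Theory of Semilinear Parabolic Equations*, LNM 840 (1981), Thm. 1.4.3.  For the LINEAR
mild (Volterra) equation `w(t) = T(t) x − ∫₀ᵗ K(t − s) G(s) ds` with an inhomogeneity Lipschitz in the
solution, `‖G₁(s) − G₂(s)‖ ≤ β ‖w₁(s) − w₂(s)‖` (e.g. `G(s) = B(s) w(s)`, `‖B(s)‖ ≤ β`: Henry 1981, §7.1, the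
linearisation `B(s) = N(y(s), ·) + N(·, y(s))` of `y' + Ay + N(y, y) = f` along a mild solution, Cor. 3.4.6):

* `exists_forall_norm_le_of_linearMild` — **a priori bound uniformly in the horizon**: one constant
  `Lip(α, C, β, L)` with `‖w(t)‖ ≤ Lip ‖x‖` on `[0, L']` for every `L' ≤ L` (the stability estimate against
  the zero solution; Henry 1981, Lemma 7.1.1);
* `linearMild_shift` — the identity from `0` gives the identity from any `a ∈ [0, b]` for `t ↦ w(a + t)`
  (`integral_duhamel_split` with zero forcing);
* `linearMild_eq_of_tendsto` (`linearMild_eq_of_tendsto'` with strongly continuous coefficients) —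
  **identification of a solution built from positive times**: if `u` solves the
  equation with coefficients `B` on `[0, L]`, and `z` solves it on `[ε, L]` from its own value `z(ε)` for every
  `ε > 0` and `z(ε) → u(0)` as `ε → 0⁺`, then `z = u` on `(0, L]` (stability on `[ε, L]` with the uniform constant,
  then `ε → 0`).  This is how a classical solution of a linearised parabolic PDE constructed from rough data
  (classical for `t > 0` only, attaining the datum in norm) is identified with the mild solution;
* `isCompactOperator_of_linearMild` — **compactness of the solution operators**: if the `T(t)`, `t > 0`, are
  compact operators (e.g. `e^{-tA}` for `A` with compact resolvent) and solution operators `D(t)` with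
  `‖D(t)‖ ≤ M` solve `D(t) h = T(t) h − ∫₀ᵗ K(t − s) B(s) D(s) h ds` with `‖B(s)‖ ≤ β`, then every `D(t)`,
  `t > 0`, is compact: `D(t) = T(ε) D(t − ε) − R_ε` with `‖R_ε‖ ≤ C β M ε^{1−α}/(1 − α)` by the shifted
  identity, and norm limits of compact operators are compact (Henry 1981, proof of Thm. 4.2.2 pattern;
  Constantin–Foias 1988, Ch. 14: the linearised Navier–Stokes solution operators are compact and injective).

Deliberately NOT here: existence (`LinearMildFlow.lean`, `exists_linearMildFlow`), injectivity / backward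
uniqueness (a PDE fact, `TorusLinearisedNSBackwardUniqueness.lean`).

## References

* D. Henry, *Geometric Theory of Semilinear Parabolic Equations*, LNM 840, Springer (1981), Thm. 1.4.3,
  Thm. 3.3.3, Thm. 3.4.1, Cor. 3.4.6, §7.1, Lemma 7.1.1. [Henry1981]
* A. Pazy, *Semigroups of Linear Operators and Applications to Partial Differential Equations*, Springer
  (1983), §6.3, Thm. 6.3.1. [Pazy1983]
* P. Constantin, C. Foias, *Navier–Stokes Equations*, Univ. Chicago Press (1988), Ch. 14. [ConstantinFoiasNSE1988]
-/

open Set Filter MeasureTheory intervalIntegral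
open _root_.Topology

namespace Literature.Analysis.UnboundedOperators

variable {E : Type*} [NormedAddCommGroup E] [NormedSpace ℝ E]

/-! ### Continuous extension off a compact interval -/

/-- The linear Duhamel term only sees the inhomogeneity on `[0, t]`: if `G = G'` on `[0, b]` and
`0 ≤ t ≤ b` then `∫₀ᵗ K(t − s) G(s) ds = ∫₀ᵗ K(t − s) G'(s) ds`. [folklore] -/
theorem integral_duhamel_congr (K : ℝ → E →L[ℝ] E) {G G' : ℝ → E} {b t : ℝ} (ht : t ∈ Icc 0 b)
    (h : ∀ s ∈ Icc 0 b, G s = G' s) :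
    ∫ s in (0 : ℝ)..t, K (t - s) (G s) = ∫ s in (0 : ℝ)..t, K (t - s) (G' s) := by
  refine intervalIntegral.integral_congr fun s hs => ?_
  rw [uIcc_of_le ht.1] at hs
  simp only [h s ⟨hs.1, hs.2.trans ht.2⟩]

/-! ### Lipschitz stability of the linear mild equation, uniformly in the horizon -/

/-- **A priori bound for the linear mild equation, uniformly in the horizon**: with `Lip(α, C, β, L)` as in
`exists_forall_norm_sub_le_of_linearMild` (`LinearMildUniqueness.lean`), every curve `z` continuous on
`[0, L']`, `L' ≤ L`, with continuous source `s ↦ B(s) z(s)`, solving `z(t) = T(t) x − ∫₀ᵗ K(t − s) B(s) z(s) ds`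
with `‖B(s)‖ ≤ β` on `[0, L']`, satisfies `‖z(t)‖ ≤ Lip ‖x‖` there (compare with the zero solution from the
zero datum; Henry 1981, Lemma 7.1.1).  For solution operators `z = W(·) x` this is the uniform bound
`‖W(t)‖ ≤ Lip`. [cite: Henry1981, Lemma 7.1.1] -/
theorem exists_forall_norm_le_of_linearMild (T K : ℝ → E →L[ℝ] E) (hTnorm : ∀ t, 0 ≤ t → ‖T t‖ ≤ 1)
    {α C : ℝ} (hα : α < 1) (hC : 0 ≤ C) (hK : ∀ t, 0 < t → ‖K t‖ ≤ C * t ^ (-α))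
    (hKc : ∀ y : E, ContinuousOn (fun t : ℝ => K t y) (Ioi 0)) (β L : ℝ) :
    ∃ Lip : ℝ, 1 ≤ Lip ∧ ∀ L' ≤ L, ∀ (B : ℝ → E →L[ℝ] E) (z : ℝ → E) (x : E),
      (∀ s ∈ Icc 0 L', ‖B s‖ ≤ β) → ContinuousOn z (Icc 0 L') →
      ContinuousOn (fun s => B s (z s)) (Icc 0 L') →
      (∀ t ∈ Icc 0 L', z t = T t x - ∫ s in (0 : ℝ)..t, K (t - s) (B s (z s))) →
      ∀ t ∈ Icc 0 L', ‖z t‖ ≤ Lip * ‖x‖ := by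
  obtain ⟨Lip, hLip1, hLip⟩ := exists_forall_norm_sub_le_of_linearMild T K hTnorm hα hC hK hKc β L
  refine ⟨Lip, hLip1, fun L' hL' B z x hB hz hg hZ t ht => ?_⟩
  have h := hLip L' hL' B z (fun _ => 0) x 0 hB hz continuousOn_const hg
    (by simp only [map_zero]; exact continuousOn_const) hZ
    (fun s _ => by simp only [map_zero, intervalIntegral.integral_zero, sub_zero]) t ht
  simpa only [sub_zero] using h

/-! ### Shift of the linear Duhamel identity -/

/-- **Shift of the linear Duhamel identity** (Henry 1981, §3.3; Pazy 1983, §6.3): if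
`u(t) = T(t) x − ∫₀ᵗ K(t − s) G(s) ds` on `[0, b]` with `G` continuous on `[0, b]` and `0 ≤ a ≤ b`, then
`u(a + t) = T(t) u(a) − ∫₀ᵗ K(t − s) G(a + s) ds` on `[0, b − a]` (`integral_duhamel_split`: on `[0, a)` the
kernel factors as `K(a + t − s) = T(t) K(a − s)`). [folklore] -/
theorem linearMild_shift [CompleteSpace E] {T K : ℝ → E →L[ℝ] E} {α C : ℝ} (hα : α < 1)
    (hTadd : ∀ s t, 0 ≤ s → 0 ≤ t → T (s + t) = (T s).comp (T t))
    (hK : ∀ t, 0 < t → ‖K t‖ ≤ C * t ^ (-α))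
    (hKadd : ∀ s t, 0 ≤ s → 0 < t → K (s + t) = (T s).comp (K t))
    (hKc : ∀ y : E, ContinuousOn (fun t : ℝ => K t y) (Ioi 0)) {G : ℝ → E} {b : ℝ}
    (hG : ContinuousOn G (Icc 0 b)) {u : ℝ → E} {x : E} {a : ℝ} (ha : 0 ≤ a) (hab : a ≤ b)
    (h : ∀ t ∈ Icc 0 b, u t = T t x - ∫ s in (0 : ℝ)..t, K (t - s) (G s)) :
    ∀ t ∈ Icc 0 (b - a), u (a + t) = T t (u a) - ∫ s in (0 : ℝ)..t, K (t - s) (G (a + s)) := by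
  intro t ht
  obtain ⟨Gx, hGx, hGxeq⟩ := exists_continuous_eqOn_Icc hG
  have hat : a ≤ a + t := le_add_of_nonneg_right ht.1
  have hatb : a + t ∈ Icc 0 b := ⟨ha.trans hat, by linarith [ht.2]⟩
  have hT : T (a + t) x = T t (T a x) := by
    rw [add_comm, semigroup_apply_add hTadd ht.1 ha]
  -- the identity with the extended inhomogeneity, split at `a`
  have hsplit := integral_duhamel_split (T := T) hα hK hKadd hKc hGx ha hat
  simp only [add_sub_cancel_left] at hsplit
  rw [h (a + t) hatb, h a ⟨ha, hab⟩, integral_duhamel_congr K hatb fun r hr => (hGxeq hr).symm,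
    integral_duhamel_congr K ⟨ha, hab⟩ fun r hr => (hGxeq hr).symm, hsplit, hT, map_sub,
    integral_duhamel_congr K (G := fun s => G (a + s)) (b := b - a) ht fun r hr =>
      (hGxeq (x := a + r) ⟨by linarith [hr.1], by linarith [hr.2]⟩).symm]
  abel

/-! ### Identification of a solution built from positive times -/

/-- **A solution of the linear mild equation built from positive times is THE solution.**  Let `T`, `K`
be as above with moreover `T` a strongly continuous semigroup intertwined with `K` (`K(s + t) = T(s) K(t)`),
`B : [0, L] → L(E)` norm continuous with `‖B(s)‖ ≤ β`, `u` continuous on `[0, L]` with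
`u(t) = T(t) u(0) − ∫₀ᵗ K(t − s) B(s) u(s) ds`, and `z` a curve which, for every `0 < ε < L`, is continuous
on `[ε, L]` and solves the equation there from its own value,
`z(t) = T(t − ε) z(ε) − ∫₀^{t−ε} K(t − ε − s) B(ε + s) z(ε + s) ds`, and which attains the datum of `u`,
`z(ε) → u(0)` as `ε → 0⁺`.  Then `z(t) = u(t)` for all `t ∈ (0, L]`: `u` solves the same shifted equation
from `u(ε)` (`linearMild_shift`), so `‖u(t) − z(t)‖ ≤ Lip ‖u(ε) − z(ε)‖` with the horizon-uniform constant
of `exists_forall_norm_sub_le_of_linearMild`, and `ε → 0⁺`.  (Henry 1981, §3.3 / §7.1; this identifies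
classical solutions of linearised parabolic equations from rough data with the mild solution.) [folklore] -/
theorem linearMild_eq_of_tendsto [CompleteSpace E] (T K : ℝ → E →L[ℝ] E)
    (hTnorm : ∀ t, 0 ≤ t → ‖T t‖ ≤ 1) (hTadd : ∀ s t, 0 ≤ s → 0 ≤ t → T (s + t) = (T s).comp (T t))
    {α C : ℝ} (hα : α < 1) (hC : 0 ≤ C) (hK : ∀ t, 0 < t → ‖K t‖ ≤ C * t ^ (-α))
    (hKadd : ∀ s t, 0 ≤ s → 0 < t → K (s + t) = (T s).comp (K t))
    (hKc : ∀ y : E, ContinuousOn (fun t : ℝ => K t y) (Ioi 0)) {L β : ℝ} {B : ℝ → E →L[ℝ] E}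
    (hBc : ContinuousOn B (Icc 0 L)) (hB : ∀ s ∈ Icc 0 L, ‖B s‖ ≤ β) {u z : ℝ → E}
    (hu : ContinuousOn u (Icc 0 L))
    (huid : ∀ t ∈ Icc 0 L, u t = T t (u 0) - ∫ s in (0 : ℝ)..t, K (t - s) (B s (u s)))
    (hz : ∀ ε ∈ Ioo 0 L, ContinuousOn z (Icc ε L))
    (hzid : ∀ ε ∈ Ioo 0 L, ∀ t ∈ Icc ε L,
      z t = T (t - ε) (z ε) - ∫ s in (0 : ℝ)..(t - ε), K (t - ε - s) (B (ε + s) (z (ε + s))))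
    (hlim : Tendsto z (𝓝[>] 0) (𝓝 (u 0))) : ∀ t ∈ Ioc 0 L, z t = u t := by
  intro t ht
  obtain ⟨Lip, -, hLip⟩ := exists_forall_norm_sub_le_of_linearMild T K hTnorm hα hC hK hKc β L
  have hGu : ContinuousOn (fun s => B s (u s)) (Icc 0 L) := hBc.clm_apply hu
  -- the stability estimate on `[ε, L]` for every `0 < ε < t`
  have hest : ∀ ε ∈ Ioo 0 t, ‖u t - z t‖ ≤ Lip * ‖u ε - z ε‖ := by
    intro ε hε
    have hε0 : 0 ≤ ε := hε.1.le
    have hεL : ε ∈ Ioo 0 L := ⟨hε.1, hε.2.trans_le ht.2⟩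
    have hshift : ∀ s ∈ Icc 0 (L - ε), ε + s ∈ Icc ε L := fun s hs =>
      ⟨le_add_of_nonneg_right hs.1, by linarith [hs.2]⟩
    have hshift' : ∀ s ∈ Icc 0 (L - ε), ε + s ∈ Icc 0 L := fun s hs =>
      ⟨hε0.trans (hshift s hs).1, (hshift s hs).2⟩
    have hcomp : ContinuousOn (fun s : ℝ => ε + s) (Icc 0 (L - ε)) :=
      (continuous_const.add continuous_id).continuousOn
    have h := hLip (L - ε) (by linarith) (fun s => B (ε + s)) (fun s => u (ε + s)) (fun s => z (ε + s))
      (u ε) (z ε) (fun s hs => hB _ (hshift' s hs)) (hu.comp hcomp hshift') ((hz ε hεL).comp hcomp hshift)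
      (hGu.comp hcomp hshift') (((hBc.comp hcomp hshift').clm_apply ((hz ε hεL).comp hcomp hshift)))
      (linearMild_shift hα hTadd hK hKadd hKc hGu hε0 hεL.2.le huid)
      (fun s hs => by
        have h := hzid ε hεL (ε + s) (hshift s hs)
        simp only [add_sub_cancel_left] at h
        exact h)
      (t - ε) ⟨sub_nonneg.2 hε.2.le, by linarith [ht.2]⟩
    simp only [add_sub_cancel] at h
    exact h
  -- `ε → 0⁺`
  have hu0 : Tendsto u (𝓝[>] 0) (𝓝 (u 0)) :=
    ((hu 0 ⟨le_rfl, ht.1.le.trans ht.2⟩).mono_of_mem_nhdsWithin (Icc_mem_nhdsGT (ht.1.trans_le ht.2))).tendsto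
  have hlim' : Tendsto (fun ε => Lip * ‖u ε - z ε‖) (𝓝[>] 0) (𝓝 (Lip * ‖u 0 - u 0‖)) :=
    ((hu0.sub hlim).norm).const_mul Lip
  rw [sub_self, norm_zero, mul_zero] at hlim'
  have hev : ∀ᶠ ε in 𝓝[>] (0 : ℝ), ‖u t - z t‖ ≤ Lip * ‖u ε - z ε‖ :=
    mem_of_superset (Ioo_mem_nhdsGT ht.1) fun ε hε => hest ε hε
  have h0 : ‖u t - z t‖ ≤ 0 := ge_of_tendsto hlim' hev
  exact (sub_eq_zero.1 (norm_le_zero_iff.1 h0)).symm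

/-- **Identification of a solution built from positive times, with strongly continuous coefficients**: the
variant of `linearMild_eq_of_tendsto` in which norm continuity of `B` is replaced by continuity of the composite
sources `s ↦ B(s) u(s)` on `[0, L]` and `s ↦ B(s) z(s)` on each `[ε, L]` — the only consequences of norm
continuity used there.  This is the form met by the linearisation `B(s) = N(y(s), ·) + N(·, y(s))` along a
continuous curve `y` when only the continuity of `(a, x) ↦ N(a, x)` is available (Henry 1981, §3.3 / §7.1).
[folklore] -/
theorem linearMild_eq_of_tendsto' [CompleteSpace E] (T K : ℝ → E →L[ℝ] E)
    (hTnorm : ∀ t, 0 ≤ t → ‖T t‖ ≤ 1) (hTadd : ∀ s t, 0 ≤ s → 0 ≤ t → T (s + t) = (T s).comp (T t))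
    {α C : ℝ} (hα : α < 1) (hC : 0 ≤ C) (hK : ∀ t, 0 < t → ‖K t‖ ≤ C * t ^ (-α))
    (hKadd : ∀ s t, 0 ≤ s → 0 < t → K (s + t) = (T s).comp (K t))
    (hKc : ∀ y : E, ContinuousOn (fun t : ℝ => K t y) (Ioi 0)) {L β : ℝ} {B : ℝ → E →L[ℝ] E}
    (hB : ∀ s ∈ Icc 0 L, ‖B s‖ ≤ β) {u z : ℝ → E} (hu : ContinuousOn u (Icc 0 L))
    (hGu : ContinuousOn (fun s => B s (u s)) (Icc 0 L))
    (huid : ∀ t ∈ Icc 0 L, u t = T t (u 0) - ∫ s in (0 : ℝ)..t, K (t - s) (B s (u s)))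
    (hz : ∀ ε ∈ Ioo 0 L, ContinuousOn z (Icc ε L)) (hGz : ∀ ε ∈ Ioo 0 L, ContinuousOn (fun s => B s (z s)) (Icc ε L))
    (hzid : ∀ ε ∈ Ioo 0 L, ∀ t ∈ Icc ε L,
      z t = T (t - ε) (z ε) - ∫ s in (0 : ℝ)..(t - ε), K (t - ε - s) (B (ε + s) (z (ε + s))))
    (hlim : Tendsto z (𝓝[>] 0) (𝓝 (u 0))) : ∀ t ∈ Ioc 0 L, z t = u t := by
  -- the proof of `linearMild_eq_of_tendsto`, reading the two composite sources from the hypotheses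
  intro t ht
  obtain ⟨Lip, -, hLip⟩ := exists_forall_norm_sub_le_of_linearMild T K hTnorm hα hC hK hKc β L
  have hest : ∀ ε ∈ Ioo 0 t, ‖u t - z t‖ ≤ Lip * ‖u ε - z ε‖ := by
    intro ε hε
    have hε0 : 0 ≤ ε := hε.1.le
    have hεL : ε ∈ Ioo 0 L := ⟨hε.1, hε.2.trans_le ht.2⟩
    have hshift : ∀ s ∈ Icc 0 (L - ε), ε + s ∈ Icc ε L := fun s hs =>
      ⟨le_add_of_nonneg_right hs.1, by linarith [hs.2]⟩
    have hshift' : ∀ s ∈ Icc 0 (L - ε), ε + s ∈ Icc 0 L := fun s hs =>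
      ⟨hε0.trans (hshift s hs).1, (hshift s hs).2⟩
    have hcomp : ContinuousOn (fun s : ℝ => ε + s) (Icc 0 (L - ε)) :=
      (continuous_const.add continuous_id).continuousOn
    have h := hLip (L - ε) (by linarith) (fun s => B (ε + s)) (fun s => u (ε + s)) (fun s => z (ε + s))
      (u ε) (z ε) (fun s hs => hB _ (hshift' s hs)) (hu.comp hcomp hshift') ((hz ε hεL).comp hcomp hshift)
      (hGu.comp hcomp hshift') ((hGz ε hεL).comp hcomp hshift)
      (linearMild_shift hα hTadd hK hKadd hKc hGu hε0 hεL.2.le huid)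
      (fun s hs => by
        have h := hzid ε hεL (ε + s) (hshift s hs)
        simp only [add_sub_cancel_left] at h
        exact h)
      (t - ε) ⟨sub_nonneg.2 hε.2.le, by linarith [ht.2]⟩
    simp only [add_sub_cancel] at h
    exact h
  -- `ε → 0⁺`
  have hu0 : Tendsto u (𝓝[>] 0) (𝓝 (u 0)) :=
    ((hu 0 ⟨le_rfl, ht.1.le.trans ht.2⟩).mono_of_mem_nhdsWithin (Icc_mem_nhdsGT (ht.1.trans_le ht.2))).tendsto
  have hlim' : Tendsto (fun ε => Lip * ‖u ε - z ε‖) (𝓝[>] 0) (𝓝 (Lip * ‖u 0 - u 0‖)) :=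
    ((hu0.sub hlim).norm).const_mul Lip
  rw [sub_self, norm_zero, mul_zero] at hlim'
  have hev : ∀ᶠ ε in 𝓝[>] (0 : ℝ), ‖u t - z t‖ ≤ Lip * ‖u ε - z ε‖ :=
    mem_of_superset (Ioo_mem_nhdsGT ht.1) fun ε hε => hest ε hε
  have h0 : ‖u t - z t‖ ≤ 0 := ge_of_tendsto hlim' hev
  exact (sub_eq_zero.1 (norm_le_zero_iff.1 h0)).symm

/-! ### Compactness of the solution operators -/

/-- The weakly singular bound with the inhomogeneity bounded on `[0, t)` only:
`‖∫₀ᵗ K(t − s) g(s) ds‖ ≤ C t^{1−α} (1 − α)^{-1} M` whenever `‖g(s)‖ ≤ M` for `0 ≤ s < t` (the integrand is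
dominated a.e. on `(0, t)` by the integrable `C (t − s)^{−α} M`; Pazy 1983, proof of Thm. 6.3.1, (3.9)).
[folklore] -/
theorem norm_integral_duhamel_le_of_forall_mem_Ico {α C : ℝ} {K : ℝ → E →L[ℝ] E}
    (hK : ∀ t, 0 < t → ‖K t‖ ≤ C * t ^ (-α)) (hC : 0 ≤ C) (hα : α < 1) {g : ℝ → E} {M t : ℝ}
    (ht : 0 ≤ t) (hM : ∀ s ∈ Ico 0 t, ‖g s‖ ≤ M) :
    ‖∫ s in (0 : ℝ)..t, K (t - s) (g s)‖ ≤ C * t ^ (1 - α) / (1 - α) * M := by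
  -- adapted from `norm_integral_duhamel_le` (global bound on `g`)
  calc ‖∫ s in (0 : ℝ)..t, K (t - s) (g s)‖ ≤ ∫ s in (0 : ℝ)..t, C * (t - s) ^ (-α) * M := by
        refine intervalIntegral.norm_integral_le_of_norm_le ht ?_
          (((intervalIntegrable_sub_rpow_neg hα t).const_mul C).mul_const M)
        filter_upwards [compl_mem_ae_iff.mpr (Real.volume_singleton (a := t))] with s hst hs
        have hst' : s < t := lt_of_le_of_ne hs.2 hst
        calc ‖K (t - s) (g s)‖ ≤ C * (t - s) ^ (-α) * ‖g s‖ := norm_duhamelIntegrand_le hK g hst'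
          _ ≤ C * (t - s) ^ (-α) * M :=
            mul_le_mul_of_nonneg_left (hM s ⟨hs.1.le, hst'⟩)
              (mul_nonneg hC (Real.rpow_nonneg (sub_pos.2 hst').le _))
    _ = C * (t ^ (1 - α) / (1 - α)) * M := by
        rw [intervalIntegral.integral_mul_const, intervalIntegral.integral_const_mul,
          integral_sub_rpow_neg hα]
    _ = C * t ^ (1 - α) / (1 - α) * M := by ring

/-- **The solution operators of the linear mild equation are compact when the semigroup is** (Henry 1981,
§7.1 with Thm. 1.4.3; Constantin–Foias 1988, Ch. 14: compactness of the linearised solution operators).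
Let `T` be a semigroup whose operators `T(t)`, `t > 0`, are compact, `K` intertwined with `T`
(`K(s + t) = T(s) K(t)`), strongly continuous on `(0, ∞)` and weakly singular (`‖K(t)‖ ≤ C t^{−α}`, `α < 1`),
and let `D(t) ∈ L(E)` (`‖D(t)‖ ≤ M` on `[0, b]`, `s ↦ B(s) D(s) h` continuous) solve
`D(t) h = T(t) h − ∫₀ᵗ K(t − s) B(s) D(s) h ds` on `[0, b]` with `‖B(s)‖ ≤ β`.  Then `D(t)` is a compact
operator for every `t ∈ (0, b]`: by the shifted identity `D(t) = T(ε) D(t − ε) − R_ε` with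
`‖R_ε h‖ ≤ C β M ε^{1−α} (1 − α)^{-1} ‖h‖`, so `D(t)` is the operator-norm limit as `ε → 0⁺` of the compact
operators `T(ε) ∘ D(t − ε)` (`isCompactOperator_of_tendsto`). [cite: Henry1981, §7.1 and Thm 1.4.3] -/
theorem isCompactOperator_of_linearMild [CompleteSpace E] (T K : ℝ → E →L[ℝ] E)
    (hTadd : ∀ s t, 0 ≤ s → 0 ≤ t → T (s + t) = (T s).comp (T t))
    (hTcpt : ∀ t, 0 < t → IsCompactOperator (T t))
    {α C : ℝ} (hα : α < 1) (hC : 0 ≤ C) (hK : ∀ t, 0 < t → ‖K t‖ ≤ C * t ^ (-α))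
    (hKadd : ∀ s t, 0 ≤ s → 0 < t → K (s + t) = (T s).comp (K t))
    (hKc : ∀ y : E, ContinuousOn (fun t : ℝ => K t y) (Ioi 0)) {b β M : ℝ} {D B : ℝ → E →L[ℝ] E}
    (hB : ∀ s ∈ Icc 0 b, ‖B s‖ ≤ β) (hM : ∀ s ∈ Icc 0 b, ‖D s‖ ≤ M)
    (hcont : ∀ h : E, ContinuousOn (fun s => B s (D s h)) (Icc 0 b))
    (hD : ∀ (h : E), ∀ t ∈ Icc 0 b, D t h = T t h - ∫ s in (0 : ℝ)..t, K (t - s) (B s (D s h)))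
    {t : ℝ} (ht : t ∈ Ioc 0 b) : IsCompactOperator (D t) := by
  have h1α : 0 < 1 - α := sub_pos.2 hα
  have h0b : (0 : ℝ) ∈ Icc 0 b := ⟨le_rfl, ht.1.le.trans ht.2⟩
  have hβ0 : 0 ≤ β := (norm_nonneg _).trans (hB 0 h0b)
  have hM0 : 0 ≤ M := (norm_nonneg _).trans (hM 0 h0b)
  -- the remainder bound `‖(D t − T ε ∘ D (t − ε)) h‖ ≤ C ε^{1−α}/(1−α) · β M ‖h‖` for `0 < ε ≤ t`
  have hrem : ∀ ε ∈ Ioc 0 t, ∀ h : E,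
      ‖(D t - (T ε).comp (D (t - ε))) h‖ ≤ C * ε ^ (1 - α) / (1 - α) * (β * M) * ‖h‖ := by
    intro ε hε h
    have hε0 : 0 ≤ t - ε := sub_nonneg.2 hε.2
    -- the shifted identity at `a = t − ε`, relative time `ε`
    have hs := linearMild_shift hα hTadd hK hKadd hKc (hcont h) (u := fun s => D s h) hε0
      (by linarith [ht.2, hε.1]) (hD h) ε ⟨hε.1.le, by linarith [ht.2]⟩
    simp only [sub_add_cancel] at hs
    have hbd : ∀ s ∈ Ico 0 ε, ‖B (t - ε + s) (D (t - ε + s) h)‖ ≤ β * M * ‖h‖ := fun s hs' => by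
      have hr : t - ε + s ∈ Icc 0 b := ⟨by linarith [hs'.1], by linarith [hs'.2, ht.2]⟩
      calc ‖B (t - ε + s) (D (t - ε + s) h)‖ ≤ ‖B (t - ε + s)‖ * (‖D (t - ε + s)‖ * ‖h‖) :=
            (B _).le_opNorm_of_le ((D _).le_opNorm h)
        _ ≤ β * (M * ‖h‖) :=
            mul_le_mul (hB _ hr) (mul_le_mul_of_nonneg_right (hM _ hr) (norm_nonneg h))
              (mul_nonneg (norm_nonneg _) (norm_nonneg _)) hβ0
        _ = β * M * ‖h‖ := by ring
    rw [show (D t - (T ε).comp (D (t - ε))) h = D t h - T ε (D (t - ε) h) from rfl, hs, sub_sub_cancel_left,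
      norm_neg]
    calc ‖∫ s in (0 : ℝ)..ε, K (ε - s) (B (t - ε + s) (D (t - ε + s) h))‖
        ≤ C * ε ^ (1 - α) / (1 - α) * (β * M * ‖h‖) :=
          norm_integral_duhamel_le_of_forall_mem_Ico hK hC hα hε.1.le hbd
      _ = C * ε ^ (1 - α) / (1 - α) * (β * M) * ‖h‖ := by ring
  -- hence the operator-norm bound and the norm convergence `T ε ∘ D (t − ε) → D t` as `ε → 0⁺`
  have hop : ∀ ε ∈ Ioc 0 t, ‖(T ε).comp (D (t - ε)) - D t‖ ≤ C * ε ^ (1 - α) / (1 - α) * (β * M) := by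
    intro ε hε
    rw [norm_sub_rev]
    refine ContinuousLinearMap.opNorm_le_bound _ ?_ (hrem ε hε)
    exact mul_nonneg (div_nonneg (mul_nonneg hC (Real.rpow_nonneg hε.1.le _)) h1α.le)
      (mul_nonneg hβ0 hM0)
  have hrate : Tendsto (fun ε : ℝ => C * ε ^ (1 - α) / (1 - α) * (β * M)) (𝓝[>] 0) (𝓝 0) := by
    have h0 : Tendsto (fun ε : ℝ => ε ^ (1 - α)) (𝓝[>] 0) (𝓝 0) := by
      have h := (Real.continuousAt_rpow_const 0 (1 - α) (Or.inr h1α.le)).tendsto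
      rw [Real.zero_rpow h1α.ne'] at h
      exact h.mono_left nhdsWithin_le_nhds
    have h' := ((h0.const_mul C).div_const (1 - α)).mul_const (β * M)
    rw [mul_zero, zero_div, zero_mul] at h'
    exact h'
  have htend : Tendsto (fun ε : ℝ => (T ε).comp (D (t - ε))) (𝓝[>] 0) (𝓝 (D t)) := by
    rw [tendsto_iff_norm_sub_tendsto_zero]
    refine squeeze_zero_norm' ?_ hrate
    filter_upwards [Ioc_mem_nhdsGT ht.1] with ε hε
    rw [norm_norm]
    exact hop ε hε
  -- norm limits of compact operators are compact
  refine isCompactOperator_of_tendsto (l := 𝓝[>] (0 : ℝ)) htend ?_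
  filter_upwards [self_mem_nhdsWithin] with ε hε
  exact (hTcpt ε hε).comp_clm (D (t - ε))

end Literature.Analysis.UnboundedOperators
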